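import Summits.QuantumFields.BalabanUV.T4Continuum.Support.SmoothRefineSquares
import Summits.QuantumFields.BalabanUV.T4Continuum.Support.SmoothRefineAbelian
import HarnessLib

/-!
# T⁴ programme, node NE3 — the kinematic refinement lemma, abelian line, file 8: THE COARSE FLUX COCHAIN OF AN ABELIAN
# CONFIGURATION AND THE REFINED CONFIGURATION `slicePull U · exp (neutralize (whitneyPot (flux U)))` (`SmoothRefineAbelianFlux`)

Cell `pub-balaban`, NE3 formalisation swarm (`t4/formal/NE3/LEAVES.md` row S4b, unit
`b2b-balaban-t4-ne3-formalise-leaf-10`); sequel of `SmoothRefineSquares` (the fine flux cochain `fineFlux`) and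
`SmoothRefineAbelian` (the block average of `refineCfg`).  COMMUTATIVE complete normed `ℂ`-algebra `𝔸` throughout (the
abelian sanity case; the matrix instance `M_1(ℂ)` is drawn in the sequel `SmoothRefineAbelianEnd`).

§1 group bookkeeping: the reversed plaquette, translation of periodic configurations, and THE CUBE IDENTITY (the product of
the six oriented plaquette variables around a unit cube is `1` in a commutative structure group — `d ∘ d = 0`);
§2 the COARSE FLUX COCHAIN `cflux U (z; μ, ν) = log U(∂p_{μν}(z))` of a configuration with plaquettes within `a` of `1`:
`exp ∘ cflux = ` the plaquette, `‖cflux‖ ≤ 2a` (B7 (26)), ANTISYMMETRY and CLOSEDNESS (lattice Bianchi, from §1 inside the ball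
of the logarithm), periodicity;
§3 THE REFINED CONFIGURATION `refinedCfg L U := refineCfg L U (fluxPot L U)`, `fluxPot L U := neutralize L (whitneyPot L (cflux U))`:
(i) EXACTNESS `rescale L (bavg L (refinedCfg L U)) = U` (`SmoothRefineAbelian.rescale_bavg_refineCfg` +
`SmoothRefineNeutral.Tside_neutralize`); (ii) its fine plaquettes are `exp (fineFlux L (cflux U))` EXACTLY, hence within
`φ + φ²` of `1` and with logarithm `fineFlux`, `φ = 2a/L² + d·δ` (`δ` a bound on the coarse flux differences);
(iii) periodicity; (iv) the values of `fluxPot` lie in every real-stable additive subgroup containing the coarse fluxes (used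
for unitarity in the sequel).

HONEST FRAMING: finite-`T⁴` kinematics of block averaging in the ABELIAN sanity case (rung (B)+1 — NOT infinite volume, NOT
a mass gap, NOT Clay); no estimate of the programme; NE3 NOT proved (NE3-(A) CONDITIONAL on ⟨(H1), (H3ˢᵘᵖ), (H0),
SmoothRefine⟩, non-abelian kinematic lemma OPEN); no `BetaPertH`, no (B), no G-an2-4; no printed sentence is a hypothesis.
PLACEMENT (human rule 2026-08-19): our work, under `Summits/QuantumFields/BalabanUV/`.
-/

set_option autoImplicit false

open scoped BigOperators

namespace Summit.QuantumFields.BalabanUV.T4Continuum.SmoothRefineAbelianFlux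

open Literature.MathematicalPhysics.QuantumFieldTheory.Balaban1983to89
open B7Prop1Explicit B7Prop2Explicit MatrixLog SmoothRefineBlocks SmoothRefineSlices SmoothRefineInterp SmoothRefineWhitney
  SmoothRefineNeutral SmoothRefineSquares SmoothRefineAbelian AbelianBlockAverage
open NormedSpace

noncomputable section

variable {d : ℕ}


/-! ## §1 Group bookkeeping: reversed plaquettes, translations, the cube identity -/

section Group

variable {G : Type*} [Group G]

/-- The plaquette word expanded: `V(∂p) = V(z,μ) V(z+e_μ,ν) V(z+e_ν,μ)⁻¹ V(z,ν)⁻¹`. [folklore] -/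
theorem hol_plaqWord_expand (V : Site d → Fin d → G) (z : Site d) (μ ν : Fin d) :
    hol V z (plaqWord μ ν) = V z μ * V (z + e μ) ν * (V (z + e ν) μ)⁻¹ * (V z ν)⁻¹ := by
  have s1 : z + e μ + e ν - e μ = z + e ν := by abel
  have s2 : z + e μ + e ν + -e μ - e ν = z := by abel
  simp only [plaqWord, hol_cons, hol_nil, mul_one, stepHol_true, stepHol_false, Letter.vec_true, Letter.vec_false, s1, s2,
    mul_assoc]

/-- The reversed plaquette is the inverse: `V(∂p_{νμ}) = V(∂p_{μν})⁻¹`. [folklore] -/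
theorem hol_plaqWord_swap (V : Site d → Fin d → G) (z : Site d) (μ ν : Fin d) :
    hol V z (plaqWord ν μ) = (hol V z (plaqWord μ ν))⁻¹ := by
  have hrev : plaqWord ν μ = revWord (plaqWord (d := d) μ ν) := by simp [plaqWord, revWord, Letter.rev]
  rw [hrev, hol_revWord' V (x := z) z (plaqWord μ ν) (by simp [plaqWord])]

/-- A `P`-periodic configuration has `P`-periodic transporters. [folklore] -/
theorem hol_add_period (V : Site d → Fin d → G) {P : ℤ} (hV : ∀ (y : Site d) (κ μ : Fin d), V (y + P • e κ) μ = V y μ)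
    (κ : Fin d) : ∀ (w : List (Letter d)) (x : Site d), hol V (x + P • e κ) w = hol V x w
  | [], x => by simp
  | l :: w, x => by
    rw [hol_cons, hol_cons, add_right_comm, hol_add_period V hV κ w]
    congr 1
    obtain ⟨μ, b⟩ := l
    cases b
    · simp only [stepHol, Bool.false_eq_true, ↓reduceIte, Letter.vec_false]
      rw [show x + P • e κ + -e μ = (x + -e μ) + P • e κ by abel, hV]
    · simp only [stepHol, ↓reduceIte, hV]

end Group

section CommGroup

variable {G : Type*} [CommGroup G]

/-- **THE CUBE IDENTITY** (`d ∘ d = 0` for an abelian lattice gauge field): around the unit cube at `z` spanned by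
`α, β, γ`, `V(∂p_{βγ}(z+e_α)) V(∂p_{βγ}(z))⁻¹ · V(∂p_{γα}(z+e_β)) V(∂p_{γα}(z))⁻¹ · V(∂p_{αβ}(z+e_γ)) V(∂p_{αβ}(z))⁻¹ = 1`.
[folklore] -/
theorem cube_identity (V : Site d → Fin d → G) (z : Site d) (α β γ : Fin d) :
    hol V (z + e α) (plaqWord β γ) * (hol V z (plaqWord β γ))⁻¹ *
      (hol V (z + e β) (plaqWord γ α) * (hol V z (plaqWord γ α))⁻¹) *
      (hol V (z + e γ) (plaqWord α β) * (hol V z (plaqWord α β))⁻¹) = 1 := by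
  have s1 : z + e β + e α = z + e α + e β := by abel
  have s2 : z + e γ + e α = z + e α + e γ := by abel
  have s3 : z + e γ + e β = z + e β + e γ := by abel
  simp only [hol_plaqWord_expand, s1, s2, s3]
  apply Additive.ofMul.injective
  simp only [ofMul_mul, ofMul_inv, ofMul_one]
  abel

end CommGroup

/-! ## §2 The coarse flux cochain of an abelian configuration with small plaquettes -/

section Flux

variable {𝔸 : Type*} [NormedCommRing 𝔸] [NormedAlgebra ℂ 𝔸] [CompleteSpace 𝔸]

/-- THE COARSE FLUX COCHAIN `log V(∂p_{μν}(z))` (B7 (21): the series `mlog`). [folklore] -/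
def cflux (U : Site d → Fin d → 𝔸ˣ) (z : Site d) (μ ν : Fin d) : 𝔸 := mlog ((hol U z (plaqWord μ ν) : 𝔸ˣ) : 𝔸)

omit [NormedAlgebra ℂ 𝔸] [CompleteSpace 𝔸] in
/-- A small-plaquette bound extends to the degenerate plaquettes `μ = μ`. [folklore] -/
theorem norm_plaq_sub_one_le {U : Site d → Fin d → 𝔸ˣ} {a : ℝ} (ha : 0 ≤ a)
    (hs : ∀ (x : Site d) (κ κ' : Fin d), κ ≠ κ' → ‖((hol U x (plaqWord κ κ') : 𝔸ˣ) : 𝔸) - 1‖ ≤ a)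
    (x : Site d) (κ κ' : Fin d) : ‖((hol U x (plaqWord κ κ') : 𝔸ˣ) : 𝔸) - 1‖ ≤ a := by
  by_cases h : κ = κ'
  · subst h; rw [hol_plaqWord_self]; simpa using ha
  · exact hs x κ κ' h

/-- `exp (cflux U z μ ν) = V(∂p)` (plaquettes within `a < 1` of `1`). [folklore] -/
theorem exp_cflux {U : Site d → Fin d → 𝔸ˣ} {a : ℝ} (ha : 0 ≤ a) (ha1 : a < 1)
    (hs : ∀ (x : Site d) (κ κ' : Fin d), κ ≠ κ' → ‖((hol U x (plaqWord κ κ') : 𝔸ˣ) : 𝔸) - 1‖ ≤ a)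
    (z : Site d) (μ ν : Fin d) : exp (cflux U z μ ν) = ((hol U z (plaqWord μ ν) : 𝔸ˣ) : 𝔸) :=
  exp_mlog ((norm_plaq_sub_one_le ha hs z μ ν).trans_lt ha1)

/-- `‖cflux U z μ ν‖ ≤ 2a` (B7 (26), `a ≤ 1/2`). [folklore] -/
theorem norm_cflux_le {U : Site d → Fin d → 𝔸ˣ} {a : ℝ} (ha : 0 ≤ a) (ha2 : a ≤ 1 / 2)
    (hs : ∀ (x : Site d) (κ κ' : Fin d), κ ≠ κ' → ‖((hol U x (plaqWord κ κ') : 𝔸ˣ) : 𝔸) - 1‖ ≤ a)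
    (z : Site d) (μ ν : Fin d) : ‖cflux U z μ ν‖ ≤ 2 * a :=
  (norm_mlog_le_two_mul ((norm_plaq_sub_one_le ha hs z μ ν).trans ha2)).trans (by linarith [norm_plaq_sub_one_le ha hs z μ ν])

omit [CompleteSpace 𝔸] in
/-- The degenerate plaquette has zero flux. [folklore] -/
theorem cflux_self (U : Site d → Fin d → 𝔸ˣ) (z : Site d) (μ : Fin d) : cflux U z μ μ = 0 := by
  rw [cflux, hol_plaqWord_self, Units.val_one, mlog_one]

/-- **ANTISYMMETRY** `cflux U z ν μ = −cflux U z μ ν` (inside the ball of the logarithm, `a ≤ 1/4`). [folklore] -/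
theorem cflux_anti {U : Site d → Fin d → 𝔸ˣ} {a : ℝ} (ha : 0 ≤ a) (ha4 : a ≤ 1 / 4)
    (hs : ∀ (x : Site d) (κ κ' : Fin d), κ ≠ κ' → ‖((hol U x (plaqWord κ κ') : 𝔸ˣ) : 𝔸) - 1‖ ≤ a) : Anti2 (cflux U) := by
  intro z μ ν
  have hexp := exp_cflux ha (by linarith) hs z μ ν
  rw [cflux, hol_plaqWord_swap, units_val_inv_eq_exp_neg hexp.symm]
  refine B7BlockAvgLog.mlog_exp ?_
  rw [norm_neg]
  exact (norm_cflux_le ha (by linarith) hs z μ ν).trans_lt (by have := Real.log_two_gt_d9; norm_num at this ⊢; linarith)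

/-- **CLOSEDNESS (lattice Bianchi)**: `∇_α F_{βγ} + ∇_β F_{γα} + ∇_γ F_{αβ} = 0` for `F = cflux U`, from the cube identity
and the injectivity of `exp` on the ball of the logarithm (`a ≤ 1/32`). [folklore] -/
theorem cflux_closed {U : Site d → Fin d → 𝔸ˣ} {a : ℝ} (ha : 0 ≤ a) (ha32 : a ≤ 1 / 32)
    (hs : ∀ (x : Site d) (κ κ' : Fin d), κ ≠ κ' → ‖((hol U x (plaqWord κ κ') : 𝔸ˣ) : 𝔸) - 1‖ ≤ a) : Closed2 (cflux U) := by
  intro z α β γ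
  letI : NormedAlgebra ℚ 𝔸 := NormedAlgebra.restrictScalars ℚ ℂ 𝔸
  have hexp := exp_cflux ha (by linarith) hs
  set S := (cflux U (z + e α) β γ - cflux U z β γ) + (cflux U (z + e β) γ α - cflux U z γ α)
    + (cflux U (z + e γ) α β - cflux U z α β) with hS
  -- `exp S` is the cube product, i.e. `1`
  have hpair : ∀ (w : Site d) (μ ν : Fin d), exp (cflux U w μ ν - cflux U z μ ν)
      = ((hol U w (plaqWord μ ν) * (hol U z (plaqWord μ ν))⁻¹ : 𝔸ˣ) : 𝔸) := by
    intro w μ ν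
    rw [sub_eq_add_neg, exp_add_of_commute (Commute.all _ _), Units.val_mul, hexp,
      units_val_inv_eq_exp_neg (hexp z μ ν).symm]
  have hexpS : exp S = 1 := by
    rw [hS, exp_add_of_commute (Commute.all _ _), exp_add_of_commute (Commute.all _ _), hpair, hpair, hpair,
      ← Units.val_mul, ← Units.val_mul, cube_identity, Units.val_one]
  -- `S` is small, so `S = mlog (exp S) = mlog 1 = 0`
  have hSn : ‖S‖ < Real.log 2 := by
    have hb := fun w μ ν => norm_cflux_le ha (by linarith) hs w μ ν
    have h6 : ‖S‖ ≤ 12 * a := by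
      rw [hS]
      refine (norm_add_le _ _).trans ?_
      refine (add_le_add ((norm_add_le _ _).trans (add_le_add (norm_sub_le _ _) (norm_sub_le _ _))) (norm_sub_le _ _)).trans ?_
      linarith [hb (z + e α) β γ, hb z β γ, hb (z + e β) γ α, hb z γ α, hb (z + e γ) α β, hb z α β]
    have hl2 := Real.log_two_gt_d9; norm_num at hl2 ⊢; linarith
  have := B7BlockAvgLog.mlog_exp hSn
  rw [hexpS, mlog_one] at this
  exact this.symm

omit [CompleteSpace 𝔸] in
/-- Periodicity of the coarse flux cochain. [folklore] -/
theorem cflux_add_period (U : Site d → Fin d → 𝔸ˣ) {P : ℤ} (hU : ∀ (y : Site d) (κ μ : Fin d), U (y + P • e κ) μ = U y μ)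
    (z : Site d) (κ μ ν : Fin d) : cflux U (z + P • e κ) μ ν = cflux U z μ ν := by
  rw [cflux, cflux, hol_add_period U hU κ]

end Flux

/-! ## §3 The refined configuration and its properties -/

section Refined

variable {𝔸 : Type*} [NormedCommRing 𝔸] [NormedAlgebra ℂ 𝔸] [CompleteSpace 𝔸]

/-- THE FINE COCHAIN of the refinement: the neutralised Whitney potential of the coarse fluxes. [folklore] -/
def fluxPot (L : ℕ) (U : Site d → Fin d → 𝔸ˣ) : Site d → Fin d → 𝔸 := neutralize L (whitneyPot L (cflux U))

/-- THE REFINED CONFIGURATION `slicePull U · exp (fluxPot U)`. [folklore] -/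
def refinedCfg (L : ℕ) (U : Site d → Fin d → 𝔸ˣ) : Site d → Fin d → 𝔸ˣ := refineCfg L U (fluxPot L U)

/-- Size of the fine cochain: `‖fluxPot‖ ≤ (1 + 2dL + L)·d·2a`. [folklore] -/
theorem norm_fluxPot_le {L : ℕ} (hL : 1 ≤ L) {U : Site d → Fin d → 𝔸ˣ} {a : ℝ} (ha : 0 ≤ a) (ha2 : a ≤ 1 / 2)
    (hs : ∀ (x : Site d) (κ κ' : Fin d), κ ≠ κ' → ‖((hol U x (plaqWord κ κ') : 𝔸ˣ) : 𝔸) - 1‖ ≤ a) (y : Site d)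
    (ν : Fin d) : ‖fluxPot L U y ν‖ ≤ (1 + (2 * (d * L) + L)) * (d * (2 * a)) :=
  norm_neutralize_le hL _ (by positivity) (norm_whitneyPot_le hL _ (norm_cflux_le ha ha2 hs)) y ν

/-- The loop sums of (42) of the fine cochain are in the ball of the logarithm under the smallness condition
`(2dL + 2L)(1 + 2dL + L)·d·2a ≤ 1/2`. [folklore] -/
theorem norm_asum_fluxPot_loop_lt {L : ℕ} (hL : 1 ≤ L) {U : Site d → Fin d → 𝔸ˣ} {a : ℝ} (ha : 0 ≤ a)
    (ha2 : a ≤ 1 / 2) (hs : ∀ (x : Site d) (κ κ' : Fin d), κ ≠ κ' → ‖((hol U x (plaqWord κ κ') : 𝔸ˣ) : 𝔸) - 1‖ ≤ a)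
    (hsm : ((2 * (d * L) + L + L : ℕ) : ℝ) * ((1 + (2 * (d * L) + L)) * (d * (2 * a))) ≤ 1 / 2) (z : Site d) (κ : Fin d)
    (r : Fin d → Fin L) :
    ‖asum (fluxPot L U) ((L : ℤ) • z) (gammaWord L κ (boxVec L r) ++ seg κ (-(L : ℤ)))‖ < Real.log 2 := by
  have h := norm_asum_loop_le L (fluxPot L U) ((L : ℤ) • z) κ (a := (1 + (2 * (d * L) + L)) * (d * (2 * a)))
    (by positivity) (fun x μ _ => norm_fluxPot_le hL ha ha2 hs x μ) r
  exact (h.trans hsm).trans_lt (by have := Real.log_two_gt_d9; norm_num at this ⊢; linarith)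

/-- **EXACTNESS OF THE ABELIAN REFINEMENT**: `rescale L (bavg L (refinedCfg L U)) = U`. [folklore] -/
theorem rescale_bavg_refinedCfg {L : ℕ} (hL : 1 ≤ L) {U : Site d → Fin d → 𝔸ˣ} {a : ℝ} (ha : 0 ≤ a) (ha2 : a ≤ 1 / 2)
    (hs : ∀ (x : Site d) (κ κ' : Fin d), κ ≠ κ' → ‖((hol U x (plaqWord κ κ') : 𝔸ˣ) : 𝔸) - 1‖ ≤ a)
    (hsm : ((2 * (d * L) + L + L : ℕ) : ℝ) * ((1 + (2 * (d * L) + L)) * (d * (2 * a))) ≤ 1 / 2) :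
    rescale L (bavg L (refinedCfg L U)) = U :=
  rescale_bavg_refineCfg hL U _ (norm_asum_fluxPot_loop_lt hL ha ha2 hs hsm) (Tside_neutralize hL _)

/-- **THE FINE PLAQUETTES ARE `exp (fineFlux)` EXACTLY** (`κ ≠ κ'`, `a ≤ 1/32`). [folklore] -/
theorem hol_refinedCfg_plaqWord {L : ℕ} (hL : 1 ≤ L) {U : Site d → Fin d → 𝔸ˣ} {a : ℝ} (ha : 0 ≤ a) (ha32 : a ≤ 1 / 32)
    (hs : ∀ (x : Site d) (κ κ' : Fin d), κ ≠ κ' → ‖((hol U x (plaqWord κ κ') : 𝔸ˣ) : 𝔸) - 1‖ ≤ a) (y : Site d)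
    {κ κ' : Fin d} (hκ : κ ≠ κ') :
    ((hol (refinedCfg L U) y (plaqWord κ κ') : 𝔸ˣ) : 𝔸) = exp (fineFlux L (cflux U) y κ κ') := by
  letI : NormedAlgebra ℚ 𝔸 := NormedAlgebra.restrictScalars ℚ ℂ 𝔸
  rw [refinedCfg, fluxPot, hol_refineCfg_plaqWord hL U _ y hκ, Units.val_mul, val_expUnit,
    ← cornerPull_add_dC_neutralize hL (cflux_anti ha (by linarith) hs) (cflux_closed ha ha32 hs) y hκ,
    exp_add_of_commute (Commute.all _ _)]
  congr 1
  unfold cornerPull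
  split_ifs
  · exact (exp_cflux ha (by linarith) hs _ κ κ').symm
  · simp

/-- `e^φ − 1 ≤ φ + φ²` on `[0, 1]`. [folklore] -/
theorem exp_sub_one_le_add_sq {φ : ℝ} (h0 : 0 ≤ φ) (h1 : φ ≤ 1) : Real.exp φ - 1 ≤ φ + φ ^ 2 := by
  have := expRem_le_sq h0 h1
  unfold expRem at this
  linarith

/-- **SMALL FIELD**: the fine plaquettes are within `φ + φ²` of `1`, `φ = 2a/L² + d·δ ≤ 1`, `δ` a bound on the coarse flux
differences. [folklore] -/
theorem norm_hol_refinedCfg_plaqWord_sub_one_le {L : ℕ} (hL : 1 ≤ L) {U : Site d → Fin d → 𝔸ˣ} {a δ : ℝ} (ha : 0 ≤ a)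
    (ha32 : a ≤ 1 / 32) (hs : ∀ (x : Site d) (κ κ' : Fin d), κ ≠ κ' → ‖((hol U x (plaqWord κ κ') : 𝔸ˣ) : 𝔸) - 1‖ ≤ a)
    (hδ0 : 0 ≤ δ) (hδ : ∀ (x : Site d) (α μ ν : Fin d), ‖cflux U (x + e α) μ ν - cflux U x μ ν‖ ≤ δ)
    (hφ : 2 * a / (L : ℝ) ^ 2 + d * δ ≤ 1) (y : Site d) {κ κ' : Fin d} (hκ : κ ≠ κ') :
    ‖((hol (refinedCfg L U) y (plaqWord κ κ') : 𝔸ˣ) : 𝔸) - 1‖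
      ≤ (2 * a / (L : ℝ) ^ 2 + d * δ) + (2 * a / (L : ℝ) ^ 2 + d * δ) ^ 2 := by
  have hf := norm_fineFlux_le hL (cflux_anti ha (by linarith) hs) (cflux_closed ha ha32 hs)
    (norm_cflux_le ha (by linarith) hs) hδ0 hδ y hκ
  rw [hol_refinedCfg_plaqWord hL ha ha32 hs y hκ]
  exact (norm_exp_sub_one_le_of_norm_le hf).1.trans (exp_sub_one_le_add_sq (by positivity) hφ)

/-- **THE FINE FLUX**: `log` of a fine plaquette of the refined configuration is `fineFlux` (`φ ≤ 1/2`). [folklore] -/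
theorem mlog_hol_refinedCfg_plaqWord {L : ℕ} (hL : 1 ≤ L) {U : Site d → Fin d → 𝔸ˣ} {a δ : ℝ} (ha : 0 ≤ a)
    (ha32 : a ≤ 1 / 32) (hs : ∀ (x : Site d) (κ κ' : Fin d), κ ≠ κ' → ‖((hol U x (plaqWord κ κ') : 𝔸ˣ) : 𝔸) - 1‖ ≤ a)
    (hδ0 : 0 ≤ δ) (hδ : ∀ (x : Site d) (α μ ν : Fin d), ‖cflux U (x + e α) μ ν - cflux U x μ ν‖ ≤ δ)
    (hφ : 2 * a / (L : ℝ) ^ 2 + d * δ ≤ 1 / 2) (y : Site d) {κ κ' : Fin d} (hκ : κ ≠ κ') :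
    mlog (((hol (refinedCfg L U) y (plaqWord κ κ') : 𝔸ˣ) : 𝔸)) = fineFlux L (cflux U) y κ κ' := by
  have hf := norm_fineFlux_le hL (cflux_anti ha (by linarith) hs) (cflux_closed ha ha32 hs)
    (norm_cflux_le ha (by linarith) hs) hδ0 hδ y hκ
  rw [hol_refinedCfg_plaqWord hL ha ha32 hs y hκ]
  exact B7BlockAvgLog.mlog_exp ((hf.trans hφ).trans_lt (by have := Real.log_two_gt_d9; norm_num at this ⊢; linarith))

/-- Periodicity of the refined configuration: `P`-periodic `U` gives `(L·P)`-periodic `refinedCfg L U`. [folklore] -/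
theorem refinedCfg_add_period {L : ℕ} (hL : 1 ≤ L) (U : Site d → Fin d → 𝔸ˣ) {P : ℤ}
    (hU : ∀ (y : Site d) (κ μ : Fin d), U (y + P • e κ) μ = U y μ) (y : Site d) (κ μ : Fin d) :
    refinedCfg L U (y + ((L : ℤ) * P) • e κ) μ = refinedCfg L U y μ :=
  refineCfg_add_period hL U _ hU
    (neutralize_add_period hL _ (whitneyPot_add_period hL (fun z κ' μ' ν' => cflux_add_period U hU z κ' μ' ν'))) y κ μ

omit [CompleteSpace 𝔸] in
/-- The values of the fine cochain lie in every real-stable additive subgroup containing the coarse fluxes (for the sequel: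
skew-adjointness, hence unitarity). [folklore] -/
theorem fluxPot_mem (K : AddSubgroup 𝔸) (hK : ∀ (r : ℝ) (x : 𝔸), x ∈ K → r • x ∈ K) (L : ℕ) {U : Site d → Fin d → 𝔸ˣ}
    (hU : ∀ z μ ν, cflux U z μ ν ∈ K) (y : Site d) (ν : Fin d) : fluxPot L U y ν ∈ K :=
  neutralize_mem K hK L (whitneyPot_mem K hK L hU) y ν

end Refined

end

end Summit.QuantumFields.BalabanUV.T4Continuum.SmoothRefineAbelianFlux
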